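/-
Copyright: rh-split cell (screw, prover seat l19) gen 0, 2026-08-27.  Splitting search over kernel-typed
RH-equivalences.  A splitting `A ∧ B ⟹ RH` is CONDITIONAL bookkeeping unless `A` and `B` are both
proved; nothing here bears on the truth of RH.
-/
import Summits.RiemannHypothesis.RiemannHypothesis.Theorems.Splittings.ScrewLatticePringsheim
import Summits.RiemannHypothesis.RiemannHypothesis.Theses.ScrewPringsheim
import HarnessLib

/-!
# Route X-15 `ScrewPringsheim` — item `PringsheimBridge` PROVED (RH-free), the route decl by name

Substance: `ScrewLatticePringsheim.latticeCeiling_of_floor_of_rayFree` (file `ScrewLatticePringsheim.lean`):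
for `h > 0`, a sub-exponential lattice floor of `Ψ` on `hℕ` together with a closed wall `T_h` missing the
real ray `[0,1)` gives `CEIL(h)` (Vivanti–Pringsheim on the shifted non-negative samples).  The route decl
`Theses.ScrewPringsheim.PringsheimBridge` is that statement verbatim.

RH is not proved by this: `PringsheimBridge` is the RH-free leg of the CONDITIONAL splitting X-15
`PringsheimBridge ∧ RayFreeThinWall ∧ Floor ⟹ RH` (`RayFreeThinWall`, `Floor` open conjectures).
No `sorry`, no new axioms, no instances, no notation.
-/

set_option linter.dupNamespace false

namespace Summit.RiemannHypothesis.RiemannHypothesis.Theorems.Splittings.ScrewLatticePringsheim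

/-- **Item `PringsheimBridge` of route `ScrewPringsheim` (X-15) — PROVED** (the route decl by name;
RH-free). -/
theorem pringsheimBridge_proof :
    Summit.RiemannHypothesis.RiemannHypothesis.Theses.ScrewPringsheim.PringsheimBridge :=
  fun _ hh hsef hray ↦ latticeCeiling_of_floor_of_rayFree hh hsef hray

end Summit.RiemannHypothesis.RiemannHypothesis.Theorems.Splittings.ScrewLatticePringsheim
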